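import Summits.NavierStokesRegularity.NavierStokesRegularity.Theses.AxisymmetricExtremality
import Summits.NavierStokesRegularity.NavierStokesRegularity.Theorems.AxisymmetricSwirlRegularity
import Literature.Analysis.FluidPDE.NSKatoToClayHolds
import Literature.Analysis.FluidPDE.KatoMaximalTime
import Literature.Analysis.FluidPDE.SuitableWeak
import HarnessLib

/-!
# Strategist s2 (independent census) — typed objects for STRATEGY-CENSUS-s2.md

Crux `AxisymmetricKatoGlobal` (stmt-NavierStokesRegularity-15453) of route AxisymmetricExtremality.
Nothing here is a registered line; these are the signatures the census refers to:

* `axisymmetricSwirlRegularity_of_crux` — PROVED: `ClayDatumCritical → AxisymmetricKatoGlobal →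
  AxisymmetricSwirlRegularity` (the crux is at least the named open problem ns.S25, modulo the
  provable-now support item ClayDatumCritical; this is the "summit-strength" certificate).
* `ThresholdInstance` (T₀) — the weakest intermediate `closes` actually consumes, with
  `thresholdInstance_of_crux` and `statement_of_thresholdInstance` PROVED (pure logic).
* `TypeIOrGlobal` / `TypeIContinues` — the Type-I/Type-II typed split, with the reason it gives
  no leverage recorded in the census (the second piece is KNSS 2009 in the Kato class; the first is
  the crux again).
-/

set_option linter.dupNamespace false

noncomputable section

open MeasureTheory Set Function Filter Topology
open scoped ENNReal NNReal ContDiff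

namespace Summit.NavierStokesRegularity.NavierStokesRegularity.Cruxes.AxisymmetricKatoGlobal.StrategistS2

open Literature.Analysis Literature.Analysis.FluidPDE Literature.Analysis.FunctionSpaces
open Summit.NavierStokesRegularity.NavierStokesRegularity.Theses.AxisymmetricExtremality

local notation "ℝ³" => EuclideanSpace ℝ (Fin 3)

/-! ### 1. Summit-strength certificate: crux ⇒ ns.S25 (conjecture leaf) -/

/-- `AxisymmetricKatoGlobal`, together with the provable-now support item `ClayDatumCritical`
(a Clay datum is an `L³` field with an `Ḣ^{1/2}` representative, weakly divergence-free), implies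
the conjecture leaf `AxisymmetricSwirlRegularity` (ns.S25: global classical bounded-energy solutions
for smooth rapidly decaying axisymmetric data WITH swirl), via the proved Kato→Clay fact. -/
theorem axisymmetricSwirlRegularity_of_crux (hC : ClayDatumCritical) (h : AxisymmetricKatoGlobal) :
    Summit.NavierStokesRegularity.NavierStokesRegularity.AxisymmetricSwirlRegularity := by
  intro ν hν u₀ hsm hdiv hdec haxi
  have hdivW : NSWave0.IsDivFree u₀ := fun x => hdiv x
  obtain ⟨hu3, hwdiv, g, hg⟩ := hC u₀ hsm hdivW hdec
  have hG : HasGlobalKatoSolution ν u₀ := h ν hν u₀ g hu3 hg hwdiv (fun θ x => haxi θ x)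
  obtain ⟨u, p, hu, hp, hns, hE⟩ :=
    clay_solution_of_hasGlobalKatoSolution_holds ν hν u₀ hsm hdivW hdec hG
  obtain ⟨hcl, h0⟩ := isNavierStokesSolution_and_smooth_iff.1 ⟨hns, hu, hp⟩
  exact ⟨u, p, hcl, h0, hE⟩

/-! ### 2. The weakest intermediate the route consumes: the threshold instance T₀ -/

/-- **T₀** — no axisymmetric Rusin–Šverák MINIMAL blow-up datum: the only instance of the crux
that `closes` uses (`h₃` is applied to the datum produced by `PFoldToAxisymmetric`). -/
def ThresholdInstance : Prop :=
  ∀ ν : ℝ, 0 < ν → ∀ (u₀ : ℝ³ → ℝ³) (g : HomSobolev ℝ³ (EuclideanSpace ℂ (Fin 3)) (1 / 2 : ℝ)),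
    IsMinimalBlowupDatum ν u₀ g → IsAxisymmetric u₀ → False

/-- crux ⇒ T₀ (trivial). -/
theorem thresholdInstance_of_crux (h : AxisymmetricKatoGlobal) : ThresholdInstance := by
  intro ν hν u₀ g hmin hax
  obtain ⟨hL3, hrep, hdiv, -, hnot⟩ := hmin
  exact hnot (h ν hν u₀ g hL3 hrep hdiv (fun θ x => hax θ x))

/-- The route's deciding theorem with T₀ in place of the crux (pure logic, same proof as
`closes`): T₀ is all the route needs from this crux. -/
theorem statement_of_thresholdInstance (h₂ : MinimalDatumPFold) (h₄ : PFoldToAxisymmetric)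
    (h₀ : ThresholdInstance) : NavierStokesRegularity := by
  show Literature.NS.NavierStokesExistenceSmoothR3
  intro ν hν u₀ hsm hdiv hdec
  by_contra hno
  obtain ⟨u₁, g, hmin, hax⟩ := h₄ ν hν (h₂ ν hν ⟨u₀, hsm, hdiv, hdec, hno⟩)
  exact h₀ ν hν u₁ g hmin (fun θ x => hax θ x)

/-! ### 3. The Type-I / Type-II typed split (no leverage: see census § Decomposition) -/

/-- **Sub₁** — an axisymmetric Kato solution from crux data whose maximal time is finite blows up at
the Type-I rate `‖u(t)‖_∞ ≤ C/√(T* − t)`. (≡ crux modulo Sub₂, which is known.) -/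
def TypeIOrGlobal : Prop :=
  ∀ ν : ℝ, 0 < ν → ∀ (u₀ : ℝ³ → ℝ³) (g : HomSobolev ℝ³ (EuclideanSpace ℂ (Fin 3)) (1 / 2 : ℝ)),
    MemLp u₀ 3 volume → g.Represents (EuclideanSpace.complexify ∘ u₀) → IsWeaklyDivFree u₀ →
    IsAxisymmetric u₀ → ∀ (T : ℝ) (u : ℝ → ℝ³ → ℝ³), 0 < T → IsKatoSolutionOn T ν u₀ u →
    katoMaximalTime ν u₀ = ENNReal.ofReal T → IsTypeIBlowup u T

/-- **Sub₂** — Type-I axisymmetric Kato solutions continue (KNSS 2009 Thm 5.3 / Seregin–Šverák 2009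
in the Kato class: `knss_no_axisymmetric_typeI` + landed stub 1 `stub_katoAxisymSingularPoint`). -/
def TypeIContinues : Prop :=
  ∀ ν : ℝ, 0 < ν → ∀ (u₀ : ℝ³ → ℝ³) (g : HomSobolev ℝ³ (EuclideanSpace ℂ (Fin 3)) (1 / 2 : ℝ)),
    MemLp u₀ 3 volume → g.Represents (EuclideanSpace.complexify ∘ u₀) → IsWeaklyDivFree u₀ →
    IsAxisymmetric u₀ → ∀ (T : ℝ) (u : ℝ → ℝ³ → ℝ³), 0 < T → IsKatoSolutionOn T ν u₀ u →
    IsTypeIBlowup u T → ENNReal.ofReal T < katoMaximalTime ν u₀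

/-! ### 4. A strengthening S⁺ (uniform swirl axis modulus) — recorded as a signature only -/

/-- **S⁺** — the crux with a conclusion strong enough to be inductive in time would have to carry
an a-priori modulus; the weakest printed one is Seregin 2022's `|Γ| ≤ C / log³(e/r)` near the axis,
uniformly up to the maximal time. As an a-priori statement over all axisymmetric Kato solutions it
is `stub_swirlAxisModulus` of line `registered`, i.e. the crux again (capstone
`AxisymmetricKatoGlobal_of_logSwirlFacts`). Typed here only as the shape "global AND modulus". -/
def StrengthenedCrux : Prop :=
  AxisymmetricKatoGlobal ∧
  ∀ ν : ℝ, 0 < ν → ∀ (u₀ : ℝ³ → ℝ³) (g : HomSobolev ℝ³ (EuclideanSpace ℂ (Fin 3)) (1 / 2 : ℝ)),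
    MemLp u₀ 3 volume → g.Represents (EuclideanSpace.complexify ∘ u₀) → IsWeaklyDivFree u₀ →
    IsAxisymmetric u₀ → ∀ (T : ℝ) (u : ℝ → ℝ³ → ℝ³), 0 < T → IsKatoSolutionOn T ν u₀ u →
    ∀ t₀ ∈ Ioo 0 T, ∃ C ρ : ℝ, 0 < ρ ∧ ∀ t ∈ Ico t₀ T, ∀ x : ℝ³,
      cylRadius x ≤ ρ → |swirl (u t) x| ≤ C / Real.log (Real.exp 1 / cylRadius x) ^ 3

theorem crux_of_strengthened (h : StrengthenedCrux) : AxisymmetricKatoGlobal := h.1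

end Summit.NavierStokesRegularity.NavierStokesRegularity.Cruxes.AxisymmetricKatoGlobal.StrategistS2

end
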